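import Summits.QuantumFields.GaugeBoot.StrongCouplingOrder
import Summits.QuantumFields.GaugeBoot.BootstrapUnitaryGroupCuts
import HarnessLib

/-!
# `SU(N)` and `U(N)` on the torus: the word-truncated bootstrap is exact at `β = 0` and its level-`n` interval has width `O(β^q)` (gauge-boot, L1 supplement)

HONEST FRAMING (cell `pub-gaugeboot`, page 1 of every file): the venture produces certified bounds
on lattice expectations at stated coupling, gauge group, dimension and torus size; NOT a mass gap,
NOT a continuum limit, NOT a string tension; NOT Yang–Mills-summit-bearing (barriers
`FixedCouplingUltralocality`, `PerturbativeInvisibility`). Structural, qualitatively quantitative: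
the constants are not computed and no number is certified.

## Content

The tree knows that the word-length truncation of the lattice bootstrap CONVERGES to the Wilson
value (`BootstrapWordTruncation.levelValues_subset_Icc_suN`) but nothing about rates. This file
instantiates the abstract strong-coupling-order analysis (`StrongCouplingOrder`) for the torus
`(ℤ/L)^d` with gauge group `SU(N)` (shifts `e^{tX}`, `X ∈ 𝔰𝔲(N)`) and `U(N)` (`X ∈ 𝔲(N)`):

* the data: `wilsonMeasure_zero_eq_pi` (at `β = 0` the Wilson measure is product Haar — the faithful
  `β = 0` state), `wilsonActionCM_mem_wordSpace` (the Wilson action is a word observable of degree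
  `4`), `torusActionDeriv` (its shift derivatives, degree `4`), `suGen`/`uGen` (bases of `𝔰𝔲(N)` /
  `𝔲(N)` as finitely many directions);
* ★★★ `levelValues_zero_eq_singleton_suN` — **at `β = 0` the level-`n` bootstrap is EXACT on every
  test function of length `≤ n`**: its feasible set is the single Haar value (indeed the rows alone
  suffice, `StrongCouplingOrder.apply_eq_of_rows_zero`);
* ★★★ `levelValues_width_le_pow_suN` / `_uN` — for a test function `P` of length `≤ n` and every
  `q`, there is `C` with: at every level `M` with `n + 4q ≤ M + 4`, `n + 4q ≤ 2M`, and every real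
  `β`, ANY TWO level-`M` feasible values of `P` differ by at most `C |β|^q`;
* ★★★ `levelValues_subset_Icc_pow_suN` — hence the level-`M` feasible values lie in
  `[W_β(P) - C|β|^q, W_β(P) + C|β|^q]` around the Wilson expectation: **the SDP bounds of the
  truncated bootstrap reproduce the strong-coupling behaviour of the Wilson loop to order
  `|β|^{(M-n)/4+1}`** (`levelValues_width_le_pow_level_suN`: the exponent as a function of the level).

NOT claimed: convergence RATES in the level at fixed `β`; explicit constants; anything at `L → ∞`.
References: Yu. Makeenko (2002) §12 Problem 12.7; P. Anderson, M. Kruczenski (2017) §3;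
V. Kazakov, Z. Zheng, arXiv:2203.11360 §4. Folklore mechanism; truncated finite-`N` statement new.
-/

noncomputable section

open MeasureTheory Filter Topology NormedSpace
open Literature.MathematicalPhysics.QuantumFieldTheory (LatticeRep haarProbability Edge GaugeConfig
  Plaquette wilsonAction wilsonWeight partitionFunction wilsonMeasure isProbabilityMeasure_wilsonMeasure
  suAlgebra mem_suAlgebra_iff)
open Literature.MathematicalPhysics.QuantumLattice

namespace Summit.QuantumFields.GaugeBoot

/-! ## Torus data: the action as a word observable, its derivatives, the `β = 0` state -/

section Torus

variable {d L : ℕ} [NeZero L] {G : Type*} [Group G] [TopologicalSpace G] [IsTopologicalGroup G]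
  [CompactSpace G] [MeasurableSpace G] [BorelSpace G] [SecondCountableTopology G] (r : LatticeRep G)

omit [SecondCountableTopology G] in
/-- **At `β = 0` the Wilson measure is the product Haar probability measure.** -/
theorem wilsonMeasure_zero_eq_pi {N : ℕ} (ρ : G →* Matrix (Fin N) (Fin N) ℂ) :
    wilsonMeasure (d := d) (L := L) ρ 0 = Measure.pi fun _ : Edge d L => haarProbability G := by
  have hw : wilsonWeight (d := d) (L := L) ρ 0 = Measure.pi fun _ : Edge d L => haarProbability G := by
    unfold wilsonWeight
    have h1 : (fun U : GaugeConfig d L G => ENNReal.ofReal (Real.exp (-0 * wilsonAction ρ U))) = 1 := by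
      funext U; simp
    rw [h1, withDensity_one]
  unfold wilsonMeasure partitionFunction
  rw [hw, measure_univ, inv_one, one_smul]

omit [SecondCountableTopology G] in
/-- The `β = 0` Wilson measure charges every nonempty open set. -/
theorem isOpenPosMeasure_wilsonMeasure_zero {N : ℕ} (ρ : G →* Matrix (Fin N) (Fin N) ℂ) :
    (wilsonMeasure (d := d) (L := L) ρ 0).IsOpenPosMeasure := by
  haveI : (haarProbability G).IsOpenPosMeasure := by unfold haarProbability; infer_instance
  rw [wilsonMeasure_zero_eq_pi]
  infer_instance

/-- **Faithfulness of the `β = 0` state**: a continuous observable with `∫ f² dμ₀ = 0` vanishes. -/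
theorem eq_zero_of_integral_mul_self_eq_zero {N : ℕ} (ρ : G →* Matrix (Fin N) (Fin N) ℂ)
    (f : C(GaugeConfig d L G, ℝ)) (h : ∫ U, (f * f) U ∂(wilsonMeasure (d := d) (L := L) ρ 0) = 0) :
    f = 0 := by
  haveI : (haarProbability G).IsOpenPosMeasure := by unfold haarProbability; infer_instance
  rw [wilsonMeasure_zero_eq_pi] at h
  have hc : Continuous fun U : GaugeConfig d L G => f U * f U := f.continuous.mul f.continuous
  have hae := (integral_eq_zero_iff_of_nonneg (fun U => mul_self_nonneg (f U))
    (integrable_of_continuous_compact hc _)).1 (by simpa only [ContinuousMap.mul_apply] using h)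
  have hz : (fun U : GaugeConfig d L G => f U * f U) = fun _ => 0 :=
    (Continuous.ae_eq_iff_eq (Measure.pi fun _ : Edge d L => haarProbability G) hc continuous_const).1 hae
  ext U
  simpa using congrFun hz U

omit [IsTopologicalGroup G] [CompactSpace G] [MeasurableSpace G] [BorelSpace G]
  [SecondCountableTopology G] in
/-- **The Wilson action is a word observable of degree `4`.** -/
theorem wilsonAction_mem_wordFunctions :
    wilsonAction (d := d) (L := L) r.ρ ∈ wordFunctions r (Set.univ : Set (Edge d L)) 4 := by
  have h : wilsonAction (d := d) (L := L) r.ρ = ∑ p : Plaquette d L,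
      fun U => ((r.N : ℝ) - (r.ρ (U (p.1, p.2.1.1) * U (p.1.shift p.2.1.1, p.2.1.2) *
        (U (p.1.shift p.2.1.2, p.2.1.1))⁻¹ * (U (p.1, p.2.1.2))⁻¹)).trace.re) := by
    funext U
    simp only [wilsonAction, Finset.sum_apply]
    rfl
  rw [h]
  exact Submodule.sum_mem _ fun p _ => const_sub_reTrace_word₄_mem_wordFunctions r
    (Set.mem_univ _) (Set.mem_univ _) (Set.mem_univ _) (Set.mem_univ _) _

/-- The Wilson action as a continuous observable. -/
def wilsonActionCM : C(GaugeConfig d L G, ℝ) :=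
  ⟨wilsonAction r.ρ, continuous_of_mem_polyFunctions r (wilsonAction_mem_polyFunctions r)⟩

omit [IsTopologicalGroup G] [CompactSpace G] [MeasurableSpace G] [BorelSpace G]
  [SecondCountableTopology G] in
/-- `wilsonActionCM` is the Wilson action. -/
@[simp] theorem coe_wilsonActionCM : ⇑(wilsonActionCM (d := d) (L := L) r) = wilsonAction r.ρ := rfl

omit [IsTopologicalGroup G] [CompactSpace G] [MeasurableSpace G] [BorelSpace G]
  [SecondCountableTopology G] in
/-- The Wilson action lies in the degree-`4` word space. -/
theorem wilsonActionCM_mem_wordSpace :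
    wilsonActionCM (d := d) (L := L) r ∈ wordSpace r ((Finset.univ : Finset (Edge d L)) : Set (Edge d L)) 4 := by
  rw [Finset.coe_univ, ← coe_mem_wordFunctions_iff, coe_wilsonActionCM]
  exact wilsonAction_mem_wordFunctions r

variable {K : Type*} (k : K → ℝ → G)

/-- **The shift derivatives of the torus Wilson action** (the `S'` of the rows). -/
def torusActionDeriv (i : Edge d L) (a : K) : C(GaugeConfig d L G, ℝ) :=
  sderiv k i a (wilsonActionCM r)

variable {k} {X : K → Matrix (Fin r.N) (Fin r.N) ℂ}

omit [CompactSpace G] [MeasurableSpace G] [BorelSpace G] [SecondCountableTopology G] in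
/-- They are word observables of degree `4`. -/
theorem torusActionDeriv_mem (hk : ∀ a s t, k a (s + t) = k a s * k a t)
    (hX : ∀ a t, r.ρ (k a t) = exp ((t : ℂ) • X a)) (i : Edge d L) (a : K) :
    torusActionDeriv r k i a ∈ wordSpace r ((Finset.univ : Finset (Edge d L)) : Set (Edge d L)) 4 :=
  sderiv_mem_wordSpace hk hX i a (wilsonActionCM_mem_wordSpace r)

omit [CompactSpace G] [MeasurableSpace G] [BorelSpace G] [SecondCountableTopology G] in
/-- They are the derivatives of the action along the shifts. -/
theorem hasDerivAt_torusActionDeriv (hk : ∀ a s t, k a (s + t) = k a s * k a t)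
    (hX : ∀ a t, r.ρ (k a t) = exp ((t : ℂ) • X a)) (i : Edge d L) (a : K) (U : GaugeConfig d L G) :
    HasDerivAt (fun t => wilsonAction r.ρ (Function.update U i (k a t * U i)))
      (torusActionDeriv r k i a U) 0 :=
  hasShiftDeriv_sderiv_of_mem_polyAlgebra hk hX i a
    (mem_polyAlgebra_of_mem_wordSpace r (wilsonActionCM_mem_wordSpace r)) U

omit [CompactSpace G] [MeasurableSpace G] [BorelSpace G] [SecondCountableTopology G] in
/-- **Rows at `β = 0` for a Wilson-feasible `β = 0` functional** (e.g. the product Haar state). -/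
theorem rows_zero_of_feasible (hk : ∀ a s t, k a (s + t) = k a s * k a t)
    (hX : ∀ a t, r.ρ (k a t) = exp ((t : ℂ) • X a)) {φ₀ : C(GaugeConfig d L G, ℝ) →ₗ[ℝ] ℝ}
    (hφ₀ : IsBootstrapFeasible r k (fun _ => wilsonAction r.ρ) 0
      (polyAlgebra (ι := Edge d L) r : Set C(GaugeConfig d L G, ℝ)) φ₀)
    (i : Edge d L) (a : K) {f : C(GaugeConfig d L G, ℝ)} (hf : f ∈ polyAlgebra (ι := Edge d L) r) :
    φ₀ (sderiv k i a f) = 0 := by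
  rw [hφ₀.rows_sderiv hk hX (hasDerivAt_torusActionDeriv r hk hX) subset_rfl i a hf, zero_mul]

end Torus

/-! ## `SU(N)` -/

section SUN

variable {d L : ℕ} [NeZero L] (N : ℕ)

/-- **A basis of `𝔰𝔲(N)` as finitely many shift directions.** -/
def suGen (m : Fin (Module.finrank ℝ (suAlgebra N))) : SuGenerator N :=
  ⟨(Module.finBasis ℝ (suAlgebra N) m : suAlgebra N), by
    have h := (mem_suAlgebra_iff _).1 (Module.finBasis ℝ (suAlgebra N) m).2
    exact ⟨skewAdjoint.mem_iff.2 (by rw [Matrix.star_eq_conjTranspose]; exact h.1), h.2⟩⟩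

/-- The basis directions span all of `𝔰𝔲(N)`. -/
theorem suGen_span (a : SuGenerator N) :
    (a : Matrix (Fin N) (Fin N) ℂ) ∈ Submodule.span ℝ (Set.range fun m => (suGen N m : Matrix (Fin N) (Fin N) ℂ)) := by
  have ha : (a : Matrix (Fin N) (Fin N) ℂ) ∈ suAlgebra N :=
    (mem_suAlgebra_iff _).2 ⟨by rw [← Matrix.star_eq_conjTranspose]; exact skewAdjoint.mem_iff.1 a.2.1, a.2.2⟩
  have hrange : (Set.range fun m => (suGen N m : Matrix (Fin N) (Fin N) ℂ)) =
      (suAlgebra N).subtype '' Set.range (Module.finBasis ℝ (suAlgebra N)) := by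
    rw [← Set.range_comp]; rfl
  rw [hrange, ← Submodule.map_span, (Module.finBasis ℝ (suAlgebra N)).span_eq, Submodule.map_top,
    Submodule.range_subtype]
  exact ha

/-- ★★★ **`SU(N)` on the torus: any two level-`M` feasible values of a length-`n` test function
differ by `O(|β|^q)`.** For `P` of word length `≤ n` and every `q` there is `C ≥ 0` with: for all
levels `M` with `n + 4q ≤ M + 4` and `n + 4q ≤ 2M`, all real `β` and all `s, t` in the level-`M`
feasible set of `P`, `|s - t| ≤ C |β|^q`. [folklore mechanism; truncated statement new] -/
theorem levelValues_width_le_pow_suN {n : ℕ} {P : C(GaugeConfig d L (Matrix.specialUnitaryGroup (Fin N) ℂ), ℝ)}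
    (hP : P ∈ wordTruncation (ι := Edge d L) (fundamentalLatticeRep N) n) (q : ℕ) :
    ∃ C : ℝ, 0 ≤ C ∧ ∀ (M : ℕ), n + 4 * q ≤ M + 4 → n + 4 * q ≤ 2 * M → ∀ β : ℝ,
      ∀ s ∈ levelValuesSuN (d := d) (L := L) N β M P, ∀ t ∈ levelValuesSuN (d := d) (L := L) N β M P,
        |s - t| ≤ C * |β| ^ q := by
  haveI : IsProbabilityMeasure (wilsonMeasure (d := d) (L := L) (fundamentalRep (Fin N)) 0) :=
    isProbabilityMeasure_wilsonMeasure (ρ := fundamentalRep (Fin N)) (continuous_fundamentalRep _) 0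
  have hP' : P ∈ wordSpace (fundamentalLatticeRep N) ((Finset.univ : Finset (Edge d L)) : Set (Edge d L)) n := by
    rw [Finset.coe_univ]; exact mem_wordSpace_univ_of_mem_wordTruncation _ hP
  have hfeas := isBootstrapFeasible_wilson_suN (d := d) (L := L) N 0 _ rfl subset_rfl
  obtain ⟨C, hC0, hC⟩ := exists_const_abs_sub_le_pow (r := fundamentalLatticeRep N) (suExp_add N)
    (X := fun X : SuGenerator N => (X : Matrix (Fin N) (Fin N) ℂ)) (rho_suExp N)
    (fun g => exists_suExp_eq N g) (suGen N) (suGen_span N)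
    (φ₀ := expectationFunctional (wilsonMeasure (fundamentalRep (Fin N)) 0))
    (rows_zero_of_feasible (fundamentalLatticeRep N) (suExp_add N) (rho_suExp N) hfeas)
    (fun f _ => expectationFunctional_sq_nonneg _ f)
    (fun f _ hf => eq_zero_of_integral_mul_self_eq_zero (fundamentalRep (Fin N)) f hf)
    (T := fun _ => Finset.univ) (torusActionDeriv_mem (fundamentalLatticeRep N) (suExp_add N) (rho_suExp N))
    (Sact := fun _ => wilsonAction (fundamentalRep (Fin N)))
    (hasDerivAt_torusActionDeriv (fundamentalLatticeRep N) (suExp_add N) (rho_suExp N)) q Finset.univ n hP'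
  refine ⟨C, hC0, fun M hM hM2 β s hs t ht => ?_⟩
  obtain ⟨φ, hφ, rfl⟩ := hs
  obtain ⟨ψ, hψ, rfl⟩ := ht
  exact hC M hM hM2 β φ ψ hφ hψ

/-- ★★★ **The truncated `SU(N)` bootstrap bounds are within `O(|β|^q)` of the Wilson value**: with `C`
as above, the level-`M` feasible values of `P` lie in `[W - C|β|^q, W + C|β|^q]`,
`W = ∫ P dμ_Wilson(β)` — the SDP upper and lower bounds reproduce the strong-coupling behaviour of
the Wilson expectation to order `q`. [folklore mechanism; truncated statement new] -/
theorem levelValues_subset_Icc_pow_suN {n : ℕ} {P : C(GaugeConfig d L (Matrix.specialUnitaryGroup (Fin N) ℂ), ℝ)}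
    (hP : P ∈ wordTruncation (ι := Edge d L) (fundamentalLatticeRep N) n) (q : ℕ) :
    ∃ C : ℝ, 0 ≤ C ∧ ∀ (M : ℕ), n + 4 * q ≤ M + 4 → n + 4 * q ≤ 2 * M → ∀ β : ℝ,
      levelValuesSuN (d := d) (L := L) N β M P ⊆
        Set.Icc (∫ U, P U ∂(wilsonMeasure (fundamentalRep (Fin N)) β) - C * |β| ^ q)
          (∫ U, P U ∂(wilsonMeasure (fundamentalRep (Fin N)) β) + C * |β| ^ q) := by
  obtain ⟨C, hC0, hC⟩ := levelValues_width_le_pow_suN (d := d) (L := L) N hP q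
  refine ⟨C, hC0, fun M hM hM2 β t ht => ?_⟩
  have h := abs_le.1 (hC M hM hM2 β t ht _ (wilson_mem_levelValues_suN N β M P))
  exact ⟨by linarith [h.1], by linarith [h.2]⟩

/-- ★★★ **The exponent as a function of the level**: for `P` of length `≤ n` and every level
`M ≥ max n 4` there is `C` with `width(levelValues M) ≤ C |β|^{(M - n)/4 + 1}` for all `β` — one order
of strong coupling per four letters of level. [folklore mechanism; truncated statement new] -/
theorem levelValues_width_le_pow_level_suN {n : ℕ} {P : C(GaugeConfig d L (Matrix.specialUnitaryGroup (Fin N) ℂ), ℝ)}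
    (hP : P ∈ wordTruncation (ι := Edge d L) (fundamentalLatticeRep N) n) {M : ℕ} (hnM : n ≤ M)
    (h4 : 4 ≤ M) :
    ∃ C : ℝ, 0 ≤ C ∧ ∀ β : ℝ, ∀ s ∈ levelValuesSuN (d := d) (L := L) N β M P,
      ∀ t ∈ levelValuesSuN (d := d) (L := L) N β M P, |s - t| ≤ C * |β| ^ ((M - n) / 4 + 1) := by
  obtain ⟨C, hC0, hC⟩ := levelValues_width_le_pow_suN (d := d) (L := L) N hP ((M - n) / 4 + 1)
  refine ⟨C, hC0, fun β s hs t ht => hC M ?_ ?_ β s hs t ht⟩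
  · have := Nat.div_mul_le_self (M - n) 4
    omega
  · have := Nat.div_mul_le_self (M - n) 4
    omega

/-- ★★★ **At `β = 0` the level-`M` `SU(N)` bootstrap is EXACT on every test function of length
`≤ M`**: its feasible set is the single Haar value. [folklore] -/
theorem levelValues_zero_eq_singleton_suN {n M : ℕ} (hnM : n ≤ M)
    {P : C(GaugeConfig d L (Matrix.specialUnitaryGroup (Fin N) ℂ), ℝ)}
    (hP : P ∈ wordTruncation (ι := Edge d L) (fundamentalLatticeRep N) n) :
    levelValuesSuN (d := d) (L := L) N 0 M P = {∫ U, P U ∂(wilsonMeasure (fundamentalRep (Fin N)) 0)} := by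
  haveI : IsProbabilityMeasure (wilsonMeasure (d := d) (L := L) (fundamentalRep (Fin N)) 0) :=
    isProbabilityMeasure_wilsonMeasure (ρ := fundamentalRep (Fin N)) (continuous_fundamentalRep _) 0
  have hP' : P ∈ wordSpace (fundamentalLatticeRep N) ((Finset.univ : Finset (Edge d L)) : Set (Edge d L)) M := by
    rw [Finset.coe_univ]; exact mem_wordSpace_univ_of_mem_wordTruncation _ (wordTruncation_mono _ hnM hP)
  have hfeas := isBootstrapFeasible_wilson_suN (d := d) (L := L) N 0 _ rfl subset_rfl
  have key : ∀ φ, IsBootstrapFeasible (fundamentalLatticeRep N) (suExp N)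
      (fun _ => wilsonAction (fundamentalRep (Fin N))) 0
      (wordTruncation (ι := Edge d L) (fundamentalLatticeRep N) M) φ →
      φ P = expectationFunctional (wilsonMeasure (d := d) (L := L) (fundamentalRep (Fin N)) 0) P /
        expectationFunctional (wilsonMeasure (d := d) (L := L) (fundamentalRep (Fin N)) 0) 1 := fun φ hφ =>
    IsBootstrapFeasible.apply_eq_of_zero (r := fundamentalLatticeRep N) (suExp_add N)
      (X := fun X : SuGenerator N => (X : Matrix (Fin N) (Fin N) ℂ)) (rho_suExp N)
      (fun g => exists_suExp_eq N g) (suGen N) (suGen_span N)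
      (rows_zero_of_feasible (fundamentalLatticeRep N) (suExp_add N) (rho_suExp N) hfeas)
      (fun f _ => expectationFunctional_sq_nonneg _ f)
      (fun f _ hf => eq_zero_of_integral_mul_self_eq_zero (fundamentalRep (Fin N)) f hf)
      (Sact := fun _ => wilsonAction (fundamentalRep (Fin N)))
      (hasDerivAt_torusActionDeriv (fundamentalLatticeRep N) (suExp_add N) (rho_suExp N)) Finset.univ M hφ hP'
  have hval : expectationFunctional (wilsonMeasure (d := d) (L := L) (fundamentalRep (Fin N)) 0) P /
      expectationFunctional (wilsonMeasure (d := d) (L := L) (fundamentalRep (Fin N)) 0) 1 =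
      ∫ U, P U ∂(wilsonMeasure (fundamentalRep (Fin N)) 0) := by
    rw [expectationFunctional_one, div_one, expectationFunctional_apply]
  refine Set.eq_singleton_iff_unique_mem.2 ⟨wilson_mem_levelValues_suN N 0 M P, fun t ht => ?_⟩
  obtain ⟨φ, hφ, rfl⟩ := ht
  rw [key φ hφ, hval]

/-- ★★★ **`SU(N)`, `β = 0`: the level-`n` loop equations ALONE — no positivity — determine every
test function of length `≤ n`**: a linear `φ` killing the shift derivatives (along `𝔰𝔲(N)`, at every
link) of all level-`n` test functions has `φ P = φ 1 · ∫ P dHaar` for every `P` of length `≤ n`.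
[folklore] -/
theorem apply_eq_haar_of_rows_zero_suN {n : ℕ}
    {P : C(GaugeConfig d L (Matrix.specialUnitaryGroup (Fin N) ℂ), ℝ)}
    (hP : P ∈ wordTruncation (ι := Edge d L) (fundamentalLatticeRep N) n)
    (φ : C(GaugeConfig d L (Matrix.specialUnitaryGroup (Fin N) ℂ), ℝ) →ₗ[ℝ] ℝ)
    (hφ : ∀ (i : Edge d L) (a : SuGenerator N),
      ∀ f ∈ wordTruncation (ι := Edge d L) (fundamentalLatticeRep N) n, φ (sderiv (suExp N) i a f) = 0) :
    φ P = φ 1 * ∫ U, P U ∂(wilsonMeasure (fundamentalRep (Fin N)) 0) := by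
  haveI : IsProbabilityMeasure (wilsonMeasure (d := d) (L := L) (fundamentalRep (Fin N)) 0) :=
    isProbabilityMeasure_wilsonMeasure (ρ := fundamentalRep (Fin N)) (continuous_fundamentalRep _) 0
  have hP' : P ∈ wordSpace (fundamentalLatticeRep N) ((Finset.univ : Finset (Edge d L)) : Set (Edge d L)) n := by
    rw [Finset.coe_univ]; exact mem_wordSpace_univ_of_mem_wordTruncation _ hP
  have hfeas := isBootstrapFeasible_wilson_suN (d := d) (L := L) N 0 _ rfl subset_rfl
  have h := apply_eq_of_rows_zero (r := fundamentalLatticeRep N) (suExp_add N)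
    (X := fun X : SuGenerator N => (X : Matrix (Fin N) (Fin N) ℂ)) (rho_suExp N)
    (fun g => exists_suExp_eq N g) (suGen N) (suGen_span N)
    (φ₀ := expectationFunctional (wilsonMeasure (fundamentalRep (Fin N)) 0))
    (rows_zero_of_feasible (fundamentalLatticeRep N) (suExp_add N) (rho_suExp N) hfeas)
    (fun f _ => expectationFunctional_sq_nonneg _ f)
    (fun f _ hf => eq_zero_of_integral_mul_self_eq_zero (fundamentalRep (Fin N)) f hf)
    Finset.univ n hφ hP'
  rw [h, expectationFunctional_one, div_one, expectationFunctional_apply, mul_comm]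

end SUN

/-! ## `U(N)` -/

section UN

variable {d L : ℕ} [NeZero L] (N : ℕ)

/-- **A basis of `𝔲(N)` as finitely many shift directions.** -/
def uGen (m : Fin (Module.finrank ℝ (skewAdjoint.submodule ℝ (Matrix (Fin N) (Fin N) ℂ)))) : UGenerator N :=
  ⟨(Module.finBasis ℝ (skewAdjoint.submodule ℝ (Matrix (Fin N) (Fin N) ℂ)) m :
      skewAdjoint.submodule ℝ (Matrix (Fin N) (Fin N) ℂ)),
    (Module.finBasis ℝ (skewAdjoint.submodule ℝ (Matrix (Fin N) (Fin N) ℂ)) m).2⟩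

/-- The basis directions span all of `𝔲(N)`. -/
theorem uGen_span (a : UGenerator N) :
    (a : Matrix (Fin N) (Fin N) ℂ) ∈ Submodule.span ℝ (Set.range fun m => (uGen N m : Matrix (Fin N) (Fin N) ℂ)) := by
  set V := skewAdjoint.submodule ℝ (Matrix (Fin N) (Fin N) ℂ) with hV
  have ha : (a : Matrix (Fin N) (Fin N) ℂ) ∈ V := a.2
  have hrange : (Set.range fun m => (uGen N m : Matrix (Fin N) (Fin N) ℂ)) =
      V.subtype '' Set.range (Module.finBasis ℝ V) := by
    rw [← Set.range_comp]; rfl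
  rw [hrange, ← Submodule.map_span, (Module.finBasis ℝ V).span_eq, Submodule.map_top, Submodule.range_subtype]
  exact ha

/-- ★★★ **`U(N)` on the torus: any two level-`M` feasible values of a length-`n` test function differ
by `O(|β|^q)`** (shifts along all of `𝔲(N)`). [folklore mechanism; truncated statement new] -/
theorem levelValues_width_le_pow_uN {n : ℕ} {P : C(GaugeConfig d L (Matrix.unitaryGroup (Fin N) ℂ), ℝ)}
    (hP : P ∈ wordTruncation (ι := Edge d L) (unitaryFundamentalLatticeRep N) n) (q : ℕ) :
    ∃ C : ℝ, 0 ≤ C ∧ ∀ (M : ℕ), n + 4 * q ≤ M + 4 → n + 4 * q ≤ 2 * M → ∀ β : ℝ,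
      ∀ s ∈ levelValuesUN (d := d) (L := L) N β M P, ∀ t ∈ levelValuesUN (d := d) (L := L) N β M P,
        |s - t| ≤ C * |β| ^ q := by
  haveI : IsProbabilityMeasure (wilsonMeasure (d := d) (L := L) (unitaryFundamentalRep (Fin N) ℂ) 0) :=
    isProbabilityMeasure_wilsonMeasure (ρ := unitaryFundamentalRep (Fin N) ℂ)
      (continuous_unitaryFundamentalRep (n := Fin N) (𝕜 := ℂ)) 0
  have hP' : P ∈ wordSpace (unitaryFundamentalLatticeRep N)
      ((Finset.univ : Finset (Edge d L)) : Set (Edge d L)) n := by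
    rw [Finset.coe_univ]; exact mem_wordSpace_univ_of_mem_wordTruncation _ hP
  have hfeas := isBootstrapFeasible_wilson_uN (d := d) (L := L) N 0 _ rfl subset_rfl
  obtain ⟨C, hC0, hC⟩ := exists_const_abs_sub_le_pow (r := unitaryFundamentalLatticeRep N) (uExp_add N)
    (X := fun X : UGenerator N => (X : Matrix (Fin N) (Fin N) ℂ)) (rho_uExp N)
    (fun g => exists_uExp_eq N g) (uGen N) (uGen_span N)
    (φ₀ := expectationFunctional (wilsonMeasure (unitaryFundamentalRep (Fin N) ℂ) 0))
    (rows_zero_of_feasible (unitaryFundamentalLatticeRep N) (uExp_add N) (rho_uExp N) hfeas)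
    (fun f _ => expectationFunctional_sq_nonneg _ f)
    (fun f _ hf => eq_zero_of_integral_mul_self_eq_zero (unitaryFundamentalRep (Fin N) ℂ) f hf)
    (T := fun _ => Finset.univ)
    (torusActionDeriv_mem (unitaryFundamentalLatticeRep N) (uExp_add N) (rho_uExp N))
    (Sact := fun _ => wilsonAction (unitaryFundamentalRep (Fin N) ℂ))
    (hasDerivAt_torusActionDeriv (unitaryFundamentalLatticeRep N) (uExp_add N) (rho_uExp N))
    q Finset.univ n hP'
  refine ⟨C, hC0, fun M hM hM2 β s hs t ht => ?_⟩
  obtain ⟨φ, hφ, rfl⟩ := hs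
  obtain ⟨ψ, hψ, rfl⟩ := ht
  exact hC M hM hM2 β φ ψ hφ hψ

end UN

end Summit.QuantumFields.GaugeBoot

end
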